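import Summits.NavierStokesRegularity.NavierStokesRegularity.Theorems.PerpetualPumpCircuitPumpActiveClock

/-!
# Joint bootstrap of the Toda clock box — instantiation lemmas
# (crux `PerpetualPump.CircuitPump`, stmt-NavierStokesRegularity-1834; line `singular-clock-gspt`,
# sub-goal `toda_boot` of `stub_clockBox`, Toda `m = 2` instance)

Elementary tools for the a-priori corridor of the clock box: the active block (scales `n = 0, 1`)
of an `L`-truncated Toda solution solves EXACTLY the abstract active system of
`toda_active_brackets` / `toda_active_core` (`lam^{(4/5)·0} = 1`, `lam^{0-1} = lam⁻¹`, …); the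
trail data in depth form `j = -n`; exponent numerology (`r = 1/ν ∈ [1/2, 1)`); the closed/open
halves of the continuity induction; and the pointwise weighted precursor/trail bounds and numerics
of the budgets of `toda_trail_slaving` (`ρb = R₀ = 13`) and `toda_precursor_tower`
(`(α, β, Zb) = (ε², 1/12, 1/4)`). [folklore]
-/

set_option linter.dupNamespace false

noncomputable section

open Set Filter Topology

namespace Summit.NavierStokesRegularity.NavierStokesRegularity.Theorems.PerpetualPumpCircuitPump

/-- Exponent numerology: `ν = lam^{4/5} ∈ (1, 3/2]`, `q = lam^{1/5} ∈ (1, 1.09]`, `q ν = lam`,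
`r = lam^{-4/5} = 1/ν ∈ [1/2, 1)`, `1 ≤ lam^{3/5} ≤ lam`. [folklore] -/
theorem boot_consts {lam ν q r : ℝ} (hlam : 1 < lam) (hlam2 : lam ≤ 3 / 2)
    (hν : ν = lam ^ (4 / 5 : ℝ)) (hq : q = lam ^ (1 / 5 : ℝ)) (hr : r = lam ^ (-(4 / 5 : ℝ))) :
    1 < ν ∧ ν ≤ 3 / 2 ∧ 1 < q ∧ q ≤ 109 / 100 ∧ q * ν = lam ∧ r * ν = 1 ∧ 1 / 2 ≤ r ∧ r < 1 ∧
    1 ≤ lam ^ (3 / 5 : ℝ) ∧ lam ^ (3 / 5 : ℝ) ≤ lam := by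
  obtain ⟨hν1, hν2, hq1, hq2, hqν, -, -⟩ := activeClock_consts hlam hlam2 hν hq
  have hlam0 : 0 < lam := by linarith
  have hrν : r * ν = 1 := by
    rw [hr, hν, ← Real.rpow_add hlam0]; norm_num
  have hν0 : 0 < ν := by linarith
  have hr' : r = ν⁻¹ := eq_inv_of_mul_eq_one_left hrν
  refine ⟨hν1, hν2, hq1, hq2, hqν, hrν, ?_, ?_, ?_, ?_⟩
  · rw [hr', le_inv_comm₀ (by norm_num) hν0]; norm_num; linarith
  · rw [hr']; exact inv_lt_one_of_one_lt₀ hν1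
  · exact Real.one_le_rpow hlam.le (by norm_num)
  · calc lam ^ (3 / 5 : ℝ) ≤ lam ^ (1 : ℝ) := Real.rpow_le_rpow_of_exponent_le hlam.le (by norm_num)
      _ = lam := Real.rpow_one lam

/-- Restriction of a truncated solution on `[0, S]` to `[0, s]`, `s ≤ S`. [folklore] -/
theorem boot_restrict {lam ε S s : ℝ} {L : ℕ} {a b : ℤ → ℝ → ℝ} (hsS : s ≤ S)
    (hvan : ∀ n : ℤ, (L : ℤ) < |n| → ∀ t ∈ Icc 0 S, a n t = 0 ∧ b n t = 0)
    (hcont : ∀ n : ℤ, |n| ≤ (L : ℤ) → ContinuousOn (a n) (Icc 0 S) ∧ ContinuousOn (b n) (Icc 0 S))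
    (hder : ∀ n : ℤ, |n| ≤ (L : ℤ) → ∀ t ∈ Ico 0 S,
      HasDerivWithinAt (a n) (-(lam ^ ((4 / 5 : ℝ) * n)) * a n t - lam ^ (n : ℝ) * b n t ^ 2 +
        lam ^ ((n : ℝ) - 1) * b (n - 1) t ^ 2 - ε * lam ^ (n : ℝ) * a n t * b n t) (Ici t) t ∧
      HasDerivWithinAt (b n) (-(lam ^ ((4 / 5 : ℝ) * n)) * b n t +
        lam ^ (n : ℝ) * b n t * (a n t - a (n + 1) t) + ε * lam ^ (n : ℝ) * a n t ^ 2) (Ici t) t) :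
    (∀ n : ℤ, (L : ℤ) < |n| → ∀ t ∈ Icc 0 s, a n t = 0 ∧ b n t = 0) ∧
    (∀ n : ℤ, |n| ≤ (L : ℤ) → ContinuousOn (a n) (Icc 0 s) ∧ ContinuousOn (b n) (Icc 0 s)) ∧
    (∀ n : ℤ, |n| ≤ (L : ℤ) → ∀ t ∈ Ico 0 s,
      HasDerivWithinAt (a n) (-(lam ^ ((4 / 5 : ℝ) * n)) * a n t - lam ^ (n : ℝ) * b n t ^ 2 +
        lam ^ ((n : ℝ) - 1) * b (n - 1) t ^ 2 - ε * lam ^ (n : ℝ) * a n t * b n t) (Ici t) t ∧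
      HasDerivWithinAt (b n) (-(lam ^ ((4 / 5 : ℝ) * n)) * b n t +
        lam ^ (n : ℝ) * b n t * (a n t - a (n + 1) t) + ε * lam ^ (n : ℝ) * a n t ^ 2) (Ici t) t) :=
  ⟨fun n hn t ht => hvan n hn t (Icc_subset_Icc_right hsS ht),
    fun n hn => ⟨(hcont n hn).1.mono (Icc_subset_Icc_right hsS),
      (hcont n hn).2.mono (Icc_subset_Icc_right hsS)⟩,
    fun n hn t ht => hder n hn t (Ico_subset_Ico_right hsS ht)⟩

/-- **The active block solves the abstract active system.** At the scales `n = 0, 1` the truncated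
Toda equations (`L ≥ 2`) are literally the hypotheses of `toda_active_brackets`/`toda_active_core`
with `u = a₀, v = b₀, w = a₁, z = b₁, e = b₋₁, y = a₂`. -/
theorem toda_boot_sys :
    ∀ (lam ν ε S : ℝ) (L : ℕ) (a b : ℤ → ℝ → ℝ), ν = lam ^ (4 / 5 : ℝ) → 2 ≤ L →
    (∀ n : ℤ, |n| ≤ (L : ℤ) → ContinuousOn (a n) (Set.Icc 0 S) ∧ ContinuousOn (b n) (Set.Icc 0 S)) →
    (∀ n : ℤ, |n| ≤ (L : ℤ) → ∀ t ∈ Set.Ico 0 S,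
      HasDerivWithinAt (a n) (-(lam ^ ((4 / 5 : ℝ) * n)) * a n t - lam ^ (n : ℝ) * b n t ^ 2 +
        lam ^ ((n : ℝ) - 1) * b (n - 1) t ^ 2 - ε * lam ^ (n : ℝ) * a n t * b n t) (Set.Ici t) t ∧
      HasDerivWithinAt (b n) (-(lam ^ ((4 / 5 : ℝ) * n)) * b n t +
        lam ^ (n : ℝ) * b n t * (a n t - a (n + 1) t) + ε * lam ^ (n : ℝ) * a n t ^ 2) (Set.Ici t) t) →
    ContinuousOn (a 0) (Set.Icc 0 S) ∧ ContinuousOn (b 0) (Set.Icc 0 S) ∧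
    ContinuousOn (a 1) (Set.Icc 0 S) ∧ ContinuousOn (b 1) (Set.Icc 0 S) ∧
    ContinuousOn (b (-1)) (Set.Icc 0 S) ∧ ContinuousOn (a 2) (Set.Icc 0 S) ∧
    (∀ t ∈ Set.Ico 0 S, HasDerivWithinAt (a 0)
      (-a 0 t - b 0 t ^ 2 + lam⁻¹ * b (-1) t ^ 2 - ε * a 0 t * b 0 t) (Set.Ici t) t) ∧
    (∀ t ∈ Set.Ico 0 S, HasDerivWithinAt (b 0)
      (b 0 t * (a 0 t - a 1 t) - b 0 t + ε * a 0 t ^ 2) (Set.Ici t) t) ∧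
    (∀ t ∈ Set.Ico 0 S, HasDerivWithinAt (a 1)
      (-ν * a 1 t + b 0 t ^ 2 - lam * b 1 t ^ 2 - ε * lam * a 1 t * b 1 t) (Set.Ici t) t) ∧
    (∀ t ∈ Set.Ico 0 S, HasDerivWithinAt (b 1)
      (b 1 t * (lam * (a 1 t - a 2 t) - ν) + ε * lam * a 1 t ^ 2) (Set.Ici t) t) := by
  intro lam ν ε S L a b hν hL hcont hder
  have h0 : |(0 : ℤ)| ≤ (L : ℤ) := by simp
  have h1 : |(1 : ℤ)| ≤ (L : ℤ) := by rw [abs_one]; exact_mod_cast (by omega : 1 ≤ L)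
  have hm1 : |(-1 : ℤ)| ≤ (L : ℤ) := by rw [abs_neg, abs_one]; exact_mod_cast (by omega : 1 ≤ L)
  have h2 : |(2 : ℤ)| ≤ (L : ℤ) := by rw [abs_two]; exact_mod_cast hL
  refine ⟨(hcont 0 h0).1, (hcont 0 h0).2, (hcont 1 h1).1, (hcont 1 h1).2, (hcont (-1) hm1).2,
    (hcont 2 h2).1, fun t ht => ?_, fun t ht => ?_, fun t ht => ?_, fun t ht => ?_⟩
  · refine ((hder 0 h0 t ht).1).congr_deriv ?_
    simp only [Int.cast_zero, mul_zero, Real.rpow_zero, zero_sub, Real.rpow_neg_one]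
    ring
  · refine ((hder 0 h0 t ht).2).congr_deriv ?_
    simp only [Int.cast_zero, mul_zero, Real.rpow_zero, zero_add]
    ring
  · refine ((hder 1 h1 t ht).1).congr_deriv ?_
    simp only [Int.cast_one, mul_one, Real.rpow_one, sub_self, Real.rpow_zero, ← hν]
    ring
  · refine ((hder 1 h1 t ht).2).congr_deriv ?_
    simp only [Int.cast_one, mul_one, Real.rpow_one, ← hν, one_add_one_eq_two]
    ring

/-- Trail data in depth form: from the `n`-indexed box bounds (`n ≤ -1`) to the `j = -n ≥ 1` form of
`toda_trail_slaving`, with `σ(-j) ≤ σb q^j`, `σb = (40/A₁) e^{κ Tmax/(1-r)}`. [folklore] -/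
theorem boot_trail_data {lam ε A₁ Tmax r : ℝ} {a b : ℤ → ℝ → ℝ} (hlam : 0 < lam) (hA₁ : 0 < A₁)
    (hK : 0 ≤ (65 + 169 / 10 * ε * A₁) * Tmax) (hr : r < 1)
    (htr : ∀ n : ℤ, n ≤ -1 → |a n 0| ≤ 13 * lam ^ (-(n : ℝ) / 5) * (2 - lam ^ ((4 / 5 : ℝ) * n)) ∧
      b n 0 ≤ 40 / A₁ * lam ^ (-(n : ℝ) / 5) *
        Real.exp ((65 + 169 / 10 * ε * A₁) * Tmax * (1 - lam ^ ((4 / 5 : ℝ) * (n + 1))) / (1 - r))) :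
    ∀ j : ℕ, 1 ≤ j → |a (-(j : ℤ)) 0| ≤ 13 * lam ^ ((j : ℝ) / 5) * (2 - lam ^ (-(4 / 5 : ℝ) * j)) ∧
      b (-(j : ℤ)) 0 ≤ 40 / A₁ * Real.exp ((65 + 169 / 10 * ε * A₁) * Tmax / (1 - r)) *
        lam ^ ((j : ℝ) / 5) := by
  intro j hj
  obtain ⟨ha, hb⟩ := htr (-(j : ℤ)) (by omega)
  have e1 : (-((-(j : ℤ) : ℤ) : ℝ) / 5) = (j : ℝ) / 5 := by push_cast; ring
  have e2 : (4 / 5 : ℝ) * ((-(j : ℤ) : ℤ) : ℝ) = -(4 / 5 : ℝ) * j := by push_cast; ring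
  rw [e1, e2] at ha
  rw [e1] at hb
  refine ⟨ha, hb.trans ?_⟩
  have hX : 0 < lam ^ ((4 / 5 : ℝ) * (((-(j : ℤ) : ℤ) : ℝ) + 1)) := Real.rpow_pos_of_pos hlam _
  calc _ ≤ 40 / A₁ * lam ^ ((j : ℝ) / 5) * Real.exp ((65 + 169 / 10 * ε * A₁) * Tmax / (1 - r)) := by
        gcongr 40 / A₁ * lam ^ ((j : ℝ) / 5) * Real.exp ?_
        refine div_le_div_of_nonneg_right ?_ (by linarith)
        nlinarith
    _ = _ := by ring

/-- The spent bond at time `0`: `b₋₁(0) ≤ σ(-1) = 40 q/A₁`. [folklore] -/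
theorem boot_bm1_init {lam q ε A₁ Tmax r : ℝ} {a b : ℤ → ℝ → ℝ} (hq : q = lam ^ (1 / 5 : ℝ))
    (htr : ∀ n : ℤ, n ≤ -1 → |a n 0| ≤ 13 * lam ^ (-(n : ℝ) / 5) * (2 - lam ^ ((4 / 5 : ℝ) * n)) ∧
      b n 0 ≤ 40 / A₁ * lam ^ (-(n : ℝ) / 5) *
        Real.exp ((65 + 169 / 10 * ε * A₁) * Tmax * (1 - lam ^ ((4 / 5 : ℝ) * (n + 1))) / (1 - r))) :
    b (-1) 0 ≤ 40 * q / A₁ := by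
  obtain ⟨-, hb⟩ := htr (-1) le_rfl
  have e1 : (-((-1 : ℤ) : ℝ) / 5) = 1 / 5 := by push_cast; ring
  have e2 : (65 + 169 / 10 * ε * A₁) * Tmax * (1 - lam ^ ((4 / 5 : ℝ) * (((-1 : ℤ) : ℝ) + 1))) /
      (1 - r) = 0 := by push_cast; simp
  rw [e1, e2, Real.exp_zero, mul_one, ← hq] at hb
  linarith [show 40 / A₁ * q = 40 * q / A₁ by ring]

/-- Closed half of the continuity induction: a bound `f ≤ c` on `[0, t)` for `f` continuous on
`[0, S] ∋ t`, `t > 0`, persists at `t`. [folklore] -/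
theorem boot_closed_le {f : ℝ → ℝ} {S t c : ℝ} (hf : ContinuousOn f (Icc 0 S)) (ht : t ∈ Ioc 0 S)
    (h : ∀ s ∈ Ico 0 t, f s ≤ c) : f t ≤ c := by
  have hC : IsClosed (Icc 0 S ∩ f ⁻¹' Iic c) := hf.preimage_isClosed_of_isClosed isClosed_Icc isClosed_Iic
  have hsub : Ico 0 t ⊆ Icc 0 S ∩ f ⁻¹' Iic c := fun s hs => ⟨⟨hs.1, hs.2.le.trans ht.2⟩, h s hs⟩
  have hmem : t ∈ closure (Ico 0 t) := by
    rw [closure_Ico ht.1.ne]; exact right_mem_Icc.2 ht.1.le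
  exact (hC.closure_subset_iff.2 hsub hmem).2

/-- Open half of the continuity induction: strict bounds at a time `T ∈ [0, S]` for functions
continuous on `[0, S]` persist (non-strictly) near `T` within `[0, S]`. [folklore] -/
theorem boot_eventually {f g h : ℝ → ℝ} {S T : ℝ} (hT : T ∈ Icc 0 S) (hf : ContinuousOn f (Icc 0 S))
    (hg : ContinuousOn g (Icc 0 S)) (hh : ContinuousOn h (Icc 0 S)) (h1 : f T < 1 / 4) (h2 : g T < 1)
    (h3 : |h T| < 1) : ∀ᶠ t in 𝓝[Icc 0 S] T, f t ≤ 1 / 4 ∧ g t ≤ 1 ∧ |h t| ≤ 1 := by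
  have e1 := (hf T hT).eventually_lt_const h1
  have e2 := (hg T hT).eventually_lt_const h2
  have e3 := ((continuous_abs.tendsto (h T)).comp (hh T hT)).eventually_lt_const h3
  filter_upwards [e1, e2, e3] with t a1 a2 a3
  exact ⟨a1.le, a2.le, le_of_lt a3⟩

/-- Weighted precursor bounds (`n ≥ 2`, weight `lam^{3n/5} ≤ (2 lam)^n`): from the outputs of
`toda_precursor_tower` with `3M ≤ 1`, `18 ε M² ≤ 1`, `β₀ = ε^{3/2}`. [folklore] -/
theorem boot_wt_prec {lam ε M x an bn bn0 : ℝ} (hlam : 1 < lam) (hx : 0 ≤ x) (hM : 3 * M ≤ 1)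
    (hε0 : 0 ≤ ε) (hε : ε ≤ 1) (hεM : 18 * ε * M ^ 2 ≤ 1)
    (ha : |an| ≤ 3 * M * (2 * lam) ^ (-x)) (hb0 : 0 ≤ bn)
    (hb : bn ≤ max bn0 (18 * ε * M ^ 2 * lam ^ (x / 5) * (2 * lam) ^ (-(2 * x))))
    (hbn0 : bn0 ≤ ε ^ (3 / 2 : ℝ) * (2 * lam) ^ (-x)) :
    lam ^ ((3 / 5 : ℝ) * x) * |an| ≤ 1 ∧ lam ^ ((3 / 5 : ℝ) * x) * |bn| ≤ 1 := by
  have hlam0 : 0 < lam := by linarith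
  have hk : ∀ c : ℝ, c ≤ 1 → 0 ≤ c → lam ^ (c * x) * (2 * lam) ^ (-x) ≤ 1 := by
    intro c hc1 hc0
    rw [Real.rpow_neg (by linarith), ← div_eq_mul_inv,
      div_le_one (Real.rpow_pos_of_pos (by linarith) _)]
    calc lam ^ (c * x) ≤ lam ^ x := Real.rpow_le_rpow_of_exponent_le hlam.le (by nlinarith)
      _ ≤ (2 * lam) ^ x := Real.rpow_le_rpow hlam0.le (by linarith) hx
  have hM0 : 0 ≤ 3 * M := by
    have h1 := (abs_nonneg an).trans ha
    have h2 : 0 < (2 * lam) ^ (-x) := Real.rpow_pos_of_pos (by linarith) _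
    nlinarith [mul_nonneg_iff_of_pos_right h2 |>.mp h1]
  constructor
  · calc lam ^ ((3 / 5 : ℝ) * x) * |an| ≤ lam ^ ((3 / 5 : ℝ) * x) * (3 * M * (2 * lam) ^ (-x)) := by
          gcongr
      _ = 3 * M * (lam ^ ((3 / 5 : ℝ) * x) * (2 * lam) ^ (-x)) := by ring
      _ ≤ 3 * M * 1 := by gcongr; exact hk _ (by norm_num) (by norm_num)
      _ ≤ 1 := by linarith
  · rw [abs_of_nonneg hb0]
    have h32 : ε ^ (3 / 2 : ℝ) ≤ 1 := Real.rpow_le_one hε0 hε (by norm_num)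
    rcases le_max_iff.mp hb with h | h
    · calc lam ^ ((3 / 5 : ℝ) * x) * bn
            ≤ lam ^ ((3 / 5 : ℝ) * x) * (ε ^ (3 / 2 : ℝ) * (2 * lam) ^ (-x)) := by
            gcongr; exact h.trans hbn0
        _ = ε ^ (3 / 2 : ℝ) * (lam ^ ((3 / 5 : ℝ) * x) * (2 * lam) ^ (-x)) := by ring
        _ ≤ 1 * 1 := by gcongr; exact hk _ (by norm_num) (by norm_num)
        _ = 1 := by ring
    · have e : (2 * lam) ^ (-(2 * x)) = (2 * lam) ^ (-x) * (2 * lam) ^ (-x) := by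
        rw [← Real.rpow_add (by linarith)]; ring_nf
      calc lam ^ ((3 / 5 : ℝ) * x) * bn
            ≤ lam ^ ((3 / 5 : ℝ) * x) *
              (18 * ε * M ^ 2 * lam ^ (x / 5) * (2 * lam) ^ (-(2 * x))) := by gcongr
        _ = 18 * ε * M ^ 2 * ((lam ^ ((3 / 5 : ℝ) * x) * (2 * lam) ^ (-x)) *
              (lam ^ ((1 / 5 : ℝ) * x) * (2 * lam) ^ (-x))) := by
            rw [e, show x / 5 = (1 / 5 : ℝ) * x by ring]; ring
        _ ≤ 1 * (1 * 1) := by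
            gcongr
            · exact hk _ (by norm_num) (by norm_num)
            · exact hk _ (by norm_num) (by norm_num)
        _ = 1 := by ring

/-- `e^{65 t} ≤ e⁹ ≤ 8104` for `t ≤ 1/8`. [folklore] -/
theorem boot_exp65 {t : ℝ} (ht : t ≤ 1 / 8) : Real.exp ((4 * 13 + 13) * t) ≤ 8104 := by
  calc Real.exp ((4 * 13 + 13) * t) ≤ Real.exp ((9 : ℕ) * 1) :=
        Real.exp_le_exp.mpr (by norm_num; linarith)
    _ = Real.exp 1 ^ 9 := Real.exp_nat_mul 1 9
    _ ≤ 2.7182818286 ^ 9 := pow_le_pow_left₀ (Real.exp_pos 1).le Real.exp_one_lt_d9.le 9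
    _ ≤ 8104 := by norm_num

/-- Weighted trail bounds (`n = -j ≤ -1`, weight `lam^{-3j/5}`): from the outputs of
`toda_trail_slaving` with `ρb = R₀ = 13`, `σb ≤ 10⁻³`, `ε ≤ 10⁻⁵`, `t ≤ 1/8`, and the carrier
budget `Ka t ≤ 13`. [folklore] -/
theorem boot_wt_trail {lam ε y Ka t a0 aa b0 bb σb : ℝ} (hlam : 1 < lam) (hy : 0 ≤ y)
    (ht0 : 0 ≤ t) (ht : t ≤ 1 / 8) (hε : ε ≤ 1 / 100000)
    (hσ : σb ≤ 1 / 1000) (hKa : Ka * t ≤ 13)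
    (ha0 : a0 ≤ 13 * lam ^ (y / 5) * (2 - lam ^ (-(4 / 5 : ℝ) * y)))
    (haa : aa ≤ a0 + Ka * lam ^ (y / 5) * lam ^ (-(4 / 5 : ℝ) * y) * t)
    (hb0 : b0 ≤ σb * lam ^ (y / 5)) (hbb0 : 0 ≤ bb)
    (hbb : bb ≤ (b0 + 4 * ε * 13 ^ 2 * lam ^ (y / 5) * t) * Real.exp ((4 * 13 + 13) * t)) :
    lam ^ ((3 / 5 : ℝ) * -y) * aa ≤ 39 ∧ lam ^ ((3 / 5 : ℝ) * -y) * |bb| ≤ 17 := by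
  have hlam0 : 0 < lam := by linarith
  have hQ : 0 < lam ^ (y / 5) := Real.rpow_pos_of_pos hlam0 _
  have hr0 : 0 < lam ^ (-(4 / 5 : ℝ) * y) := Real.rpow_pos_of_pos hlam0 _
  have hr1 : lam ^ (-(4 / 5 : ℝ) * y) ≤ 1 :=
    Real.rpow_le_one_of_one_le_of_nonpos hlam.le (by nlinarith)
  have hwQ : lam ^ ((3 / 5 : ℝ) * -y) * lam ^ (y / 5) ≤ 1 := by
    rw [← Real.rpow_add hlam0]
    exact Real.rpow_le_one_of_one_le_of_nonpos hlam.le (by nlinarith)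
  have hw0 : 0 ≤ lam ^ ((3 / 5 : ℝ) * -y) := (Real.rpow_pos_of_pos hlam0 _).le
  have hE := boot_exp65 ht
  constructor
  · have haa' : aa ≤ 39 * lam ^ (y / 5) := by
      have h1 : Ka * lam ^ (y / 5) * lam ^ (-(4 / 5 : ℝ) * y) * t ≤ 13 * lam ^ (y / 5) := by
        calc Ka * lam ^ (y / 5) * lam ^ (-(4 / 5 : ℝ) * y) * t
            = (Ka * t) * lam ^ (-(4 / 5 : ℝ) * y) * lam ^ (y / 5) := by ring
          _ ≤ 13 * 1 * lam ^ (y / 5) := by gcongr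
          _ = 13 * lam ^ (y / 5) := by ring
      nlinarith [mul_nonneg hQ.le hr0.le]
    calc lam ^ ((3 / 5 : ℝ) * -y) * aa ≤ lam ^ ((3 / 5 : ℝ) * -y) * (39 * lam ^ (y / 5)) := by
          gcongr
      _ = 39 * (lam ^ ((3 / 5 : ℝ) * -y) * lam ^ (y / 5)) := by ring
      _ ≤ 39 * 1 := by gcongr
      _ = 39 := by ring
  · rw [abs_of_nonneg hbb0]
    have hbb' : bb ≤ 17 * lam ^ (y / 5) := by
      have h1 : b0 + 4 * ε * 13 ^ 2 * lam ^ (y / 5) * t ≤ (1 / 1000 + 1 / 1000) * lam ^ (y / 5) := by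
        have : 4 * ε * 13 ^ 2 * t ≤ 1 / 1000 := by nlinarith
        nlinarith
      have h0 : 0 ≤ b0 + 4 * ε * 13 ^ 2 * lam ^ (y / 5) * t := by
        have := hbb0.trans hbb
        by_contra hneg
        push Not at hneg
        have := mul_neg_of_neg_of_pos hneg (Real.exp_pos ((4 * 13 + 13) * t))
        linarith
      calc bb ≤ _ := hbb
        _ ≤ (1 / 1000 + 1 / 1000) * lam ^ (y / 5) * 8104 :=
            mul_le_mul h1 hE (Real.exp_pos _).le (by positivity)
        _ ≤ 17 * lam ^ (y / 5) := by nlinarith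
    calc lam ^ ((3 / 5 : ℝ) * -y) * bb ≤ lam ^ ((3 / 5 : ℝ) * -y) * (17 * lam ^ (y / 5)) := by
          gcongr
      _ = 17 * (lam ^ ((3 / 5 : ℝ) * -y) * lam ^ (y / 5)) := by ring
      _ ≤ 17 * 1 := by gcongr
      _ = 17 := by ring

/-- Trail smallness at horizon `s ≤ Tmax` from the box hypothesis at `Tmax` (`1 - r ≤ 1/2`).
[folklore] -/
theorem boot_trail_small {σb ε s Tmax r : ℝ} (hσ0 : 0 ≤ σb) (hε0 : 0 ≤ ε) (hs0 : 0 ≤ s)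
    (hs : s ≤ Tmax) (hr : 1 / 2 ≤ r)
    (HS5 : 2 * (σb + 4 * ε * 169 * Tmax) ^ 2 * Real.exp (130 * Tmax) * Tmax ≤ 13 * (1 - r)) :
    2 * (σb + 4 * ε * 13 ^ 2 * s) ^ 2 * Real.exp (2 * (4 * 13 + 13) * s) * s ≤ 13 / 2 ∧
    2 * (σb + 4 * ε * 13 ^ 2 * s) ^ 2 * Real.exp (2 * (4 * 13 + 13) * s) * s ≤ 13 := by
  have e : 2 * (σb + 4 * ε * 13 ^ 2 * s) ^ 2 * Real.exp (2 * (4 * 13 + 13) * s) * s =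
      2 * (σb + 4 * ε * 169 * s) ^ 2 * Real.exp (130 * s) * s := by norm_num
  have hmono : 2 * (σb + 4 * ε * 169 * s) ^ 2 * Real.exp (130 * s) * s ≤
      2 * (σb + 4 * ε * 169 * Tmax) ^ 2 * Real.exp (130 * Tmax) * Tmax := by
    have h1 : (σb + 4 * ε * 169 * s) ^ 2 ≤ (σb + 4 * ε * 169 * Tmax) ^ 2 := by
      apply pow_le_pow_left₀ (by positivity); nlinarith
    have h2 : Real.exp (130 * s) ≤ Real.exp (130 * Tmax) := Real.exp_le_exp.mpr (by linarith)
    have h3 := mul_le_mul (mul_le_mul_of_nonneg_left h1 (by norm_num : (0 : ℝ) ≤ 2)) h2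
      (by positivity) (by positivity)
    exact mul_le_mul h3 hs hs0 (by positivity)
  rw [e]
  constructor <;> linarith

/-- Numerics of the precursor budget `M = ε² + lam³ s/4` (`(α, β, Zb) = (ε², 1/12, 1/4)`,
`s ≤ 1/8`): `0 < M ≤ 0.11`, and the side conditions of `toda_precursor_tower`. [folklore] -/
theorem boot_prec_M {lam ε s : ℝ} (hlam : 1 < lam) (hlam2 : lam ≤ 3 / 2) (hε : 0 < ε)
    (hε5 : ε ≤ 1 / 100000) (hs0 : 0 < s) (hs : s ≤ 1 / 8) :
    0 < ε ^ 2 + 4 * lam ^ 3 * (1 / 4) ^ 2 * s ∧ ε ^ 2 + 4 * lam ^ 3 * (1 / 4) ^ 2 * s ≤ 2 / 5 ∧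
    18 * ε * (ε ^ 2 + 4 * lam ^ 3 * (1 / 4) ^ 2 * s) ^ 2 ≤ 1 / 12 ∧
    28 * (1 / 12) ^ 2 * s ≤ ε ^ 2 + 4 * lam ^ 3 * (1 / 4) ^ 2 * s ∧
    3 * (ε ^ 2 + 4 * lam ^ 3 * (1 / 4) ^ 2 * s) ≤ 1 / 2 ∧
    18 * ε * (ε ^ 2 + 4 * lam ^ 3 * (1 / 4) ^ 2 * s) ^ 2 ≤ 1 ∧ ε ^ (3 / 2 : ℝ) ≤ 1 / 12 := by
  have hl3 : lam ^ 3 ≤ 27 / 8 := by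
    calc lam ^ 3 ≤ (3 / 2) ^ 3 := pow_le_pow_left₀ (by linarith) hlam2 3
      _ = 27 / 8 := by norm_num
  have hl31 : 1 ≤ lam ^ 3 := one_le_pow₀ hlam.le
  have hM1 : ε ^ 2 + 4 * lam ^ 3 * (1 / 4) ^ 2 * s ≤ 11 / 100 := by nlinarith
  have hM0 : 0 < ε ^ 2 + 4 * lam ^ 3 * (1 / 4) ^ 2 * s := by positivity
  have hM2 : (ε ^ 2 + 4 * lam ^ 3 * (1 / 4) ^ 2 * s) ^ 2 ≤ (11 / 100) ^ 2 :=
    pow_le_pow_left₀ hM0.le hM1 2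
  have h32 : ε ^ (3 / 2 : ℝ) ≤ ε := by
    have := Real.rpow_le_rpow_of_exponent_ge hε (by linarith) (by norm_num : (1 : ℝ) ≤ 3 / 2)
    rwa [Real.rpow_one] at this
  refine ⟨hM0, by linarith, by nlinarith, by nlinarith, by linarith, by nlinarith, by linarith⟩

end Summit.NavierStokesRegularity.NavierStokesRegularity.Theorems.PerpetualPumpCircuitPump
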